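import Summits.BirchSwinnertonDyer.BirchSwinnertonDyer.Theorems.SmallImageMuTransferMuTransferX9StepTwoLocal
import Literature.NumberTheory.EllipticCurves.SerreOpenImageDeterminantProofs
import Literature.NumberTheory.GaloisRepresentations.ModNCyclotomicCharacter
import HarnessLib

/-!
# An `E`-split prime is `≡ 1 (mod p)` (`stub_coreX9`, crux 19276 `MuTransferX9`): the congruence
# input `p ∣ N(v) − 1` of the local theory at the Chebotarev prime, from `det ρ̄_{E,p} = χ̄_p`

Cell `b2b-bsdres` (X9 prover lineage, GEN 44) serving the K6 route `SmallImageMuTransfer` of cell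
`bsd-smallim`. HONEST FRAMING: the cell deletes COMBINATION-SHAPED residual classes of the rank-≤1
BSD formula from PUBLISHED theorems only and TYPES the construction-shaped remainder; this is not
"finishing BSD"; class X9 stays TYPED at class level. `--supports` helper toward `stub_coreX9` of
stmt-BirchSwinnertonDyer-19276; books nothing, closes nothing; theorems only (no definition, no
named fact).

MU-TRANSFER-PROOF (F5): "If moreover `ρ̄(Fr_q) = 1` (`q` is `E`-SPLIT; then `a_q ≡ 2`, `q ≡ 1 (p)`)".
The congruence `q ≡ 1 (mod p)` is the hypothesis `hpl : p ∣ Ideal.absNorm q.asIdeal - 1` of koly's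
local theory at the split prime (`…X9LocalSplitPrime`: `isCompl_unramified_transverse_toLocal_twistModP`,
`natCard_transverse_toLocal_twistModP_of_split`, the `q`-term of Lemma 1 (iii)); STEP 2
(`…X9StepTwoElementKernels` §7 / `…X9StepTwoLocal` §3) delivers the Chebotarev prime `v` with
`ρ̄_{E,p}(Fr) = 1` for its Frobenii.  This file supplies the bridge, from the tree's
`det ρ̄_{E,p} = χ̄_p` (Weil pairing; `exists_frame_galoisRepTorsion_rat`, Serre 1972 §1.11) and
`χ̄_p(Frob_v) = N(v)` (`modNCyclotomicCharacter_eq_residueCard_of_isArithFrobAt`):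

* §1 `modPCyclotomicCharacterZMod_eq_one_of_galoisRepTorsion_eq_one`: `ρ̄_{E,p}(σ) = 1 ⟹ χ̄_p(σ) = 1`
  (over `ℚ`; `det 1 = 1`).
* §2 `residueCard_modEq_one_of_isArithFrobAt_of_galoisRepTorsion_eq_one`: for a place `v ∤ p`, a
  prime `𝔓 ∣ v` and an arithmetic Frobenius `Fr` at `𝔓` with `ρ̄_{E,p}(Fr) = 1`:
  `(N(v) : ZMod p) = 1`, `p ∣ N(v) − 1` (`Ideal.absNorm` spelling: `dvd_absNorm_sub_one_…`).
* §3 the LOCAL form at the distinguished prime of `v` (the currency of `…X9StepTwoLocal` §3 and of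
  koly's local files): for every local arithmetic Frobenius `Fr_v ∈ Γ_{ℚ_v}` with
  `ρ̄_{E,p}(res Fr_v) = 1` and `(p) ≠ v`: `p ∣ Ideal.absNorm v.asIdeal − 1` — koly's `hpl` verbatim.

PARTITION (D-0054): X9 (A4) · X10∧¬Surj (A5) at `p = 3` — hypothesis-discharging helper toward
`stub_coreX9`; closes NONE.

References: J.-P. Serre, Invent. Math. 15 (1972) §1.11, §5.2 (iii) [Serre1972]; J. H. Silverman in
Cornell–Silverman–Stevens (1997) Ch. II §7–§8 [SilvermanCSS1997]; J. Neukirch, *Algebraic Number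
Theory*, I (10.3), II §9 (9.6) [NeukirchANT1999]; L. Washington, *Cyclotomic Fields*, Lemma 2.12
[Washington1997]; HOME/koly/MU-TRANSFER-PROOF.md (F5), §5 STEP 2.
-/

-- the summit and its single problem are both named `BirchSwinnertonDyer` (registry layout D-0017)
set_option linter.dupNamespace false

set_option autoImplicit false

noncomputable section

open scoped NumberField
open Field WeierstrassCurve Literature.NumberTheory.EllipticCurves
  Literature.NumberTheory.GaloisRepresentations Function IsDedekindDomain NumberField
open Literature.NumberTheory.GaloisRepresentations.IsNonarchimedeanLocalField
open Literature.NumberTheory.Automorphic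

namespace Summit.BirchSwinnertonDyer.BirchSwinnertonDyer.Rank1Residual.SplitPrime

variable (W : WeierstrassCurve ℚ) [W.IsElliptic] (p : ℕ) [Fact p.Prime]

/-! ### §1 `ρ̄_{E,p}(σ) = 1 ⟹ χ̄_p(σ) = 1` -/

/-- **An element fixing `E[p]` fixes `μ_p`**: `ρ̄_{E,p}(σ) = 1 ⟹ χ̄_p(σ) = 1`, because
`det ρ̄_{E,p} = χ̄_p` (Weil pairing: the tree's `exists_frame_galoisRepTorsion_rat`, whose frame `Φ`
satisfies `det Φ(ρ̄ σ) = χ̄_p(σ)`) and `det 1 = 1`. MU-TRANSFER-PROOF (F5) "`q` `E`-split ⟹ `q ≡ 1 (p)`".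
[cite: Serre1972, §1.11 and §5.2 (iii)] [cite: SilvermanCSS1997, Ch. II §7 Proposition and §8] -/
theorem modPCyclotomicCharacterZMod_eq_one_of_galoisRepTorsion_eq_one {σ : absoluteGaloisGroup ℚ}
    (hσ : galoisRepTorsion W p σ = 1) : modPCyclotomicCharacterZMod ℚ p σ = 1 := by
  obtain ⟨e, Φ, -, -, hdet, -⟩ := exists_frame_galoisRepTorsion_rat W p
  rw [← hdet σ, hσ, map_one, map_one]

/-- The same from the pointwise hypothesis `σ • P = P` on `E[p]`. [cite: Serre1972, §1.11 and §5.2 (iii)] -/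
theorem modPCyclotomicCharacterZMod_eq_one_of_forall_smul_eq {σ : absoluteGaloisGroup ℚ}
    (hσ : ∀ P : geomTorsion W p, σ • P = P) : modPCyclotomicCharacterZMod ℚ p σ = 1 :=
  modPCyclotomicCharacterZMod_eq_one_of_galoisRepTorsion_eq_one W p
    (galoisRepTorsion_eq_one_of_forall_smul_eq W p hσ)

/-! ### §2 An `E`-split Frobenius sits at a place `≡ 1 (mod p)` -/

/-- **An `E`-split prime is `≡ 1 (mod p)`.**  For a finite place `v` of `ℚ`, a prime `𝔓 ∣ v` of
`\bar ℤ` not containing `p` (i.e. `v ∤ p`) and an arithmetic Frobenius `Fr` at `𝔓` with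
`ρ̄_{E,p}(Fr) = 1`: `N(v) ≡ 1 (mod p)` in the form `(N(v) : ZMod p) = 1` — `χ̄_p(Fr) = N(v)`
(`modNCyclotomicCharacter_eq_residueCard_of_isArithFrobAt`) and §1.
[cite: Serre1972, §1.11 and §5.2 (iii)] [cite: NeukirchANT1999, Ch. I (10.3)] [cite: Washington1997, Lemma 2.12] -/
theorem residueCard_eq_one_of_isArithFrobAt_of_galoisRepTorsion_eq_one
    {v : HeightOneSpectrum (𝓞 ℚ)} {𝔓 : Ideal (absIntegers (𝓞 ℚ) ℚ)} (h𝔓 : 𝔓 ∈ v.primesAbove)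
    (hp𝔓 : ((p : ℕ) : absIntegers (𝓞 ℚ) ℚ) ∉ 𝔓) {Fr : absoluteGaloisGroup ℚ}
    (hFr : IsArithFrobAt (𝓞 ℚ) Fr 𝔓) (hsplit : galoisRepTorsion W p Fr = 1) :
    ((v.residueCard : ℕ) : ZMod p) = 1 := by
  haveI : NeZero p := ⟨(Fact.out : p.Prime).ne_zero⟩
  have h := modNCyclotomicCharacter_eq_residueCard_of_isArithFrobAt (K := ℚ) (N := p) h𝔓 hp𝔓 hFr
  rw [← modPCyclotomicCharacterZMod_eq_modNCyclotomicCharacter,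
    modPCyclotomicCharacterZMod_eq_one_of_galoisRepTorsion_eq_one W p hsplit, Units.val_one] at h
  exact h.symm

/-- `p ∣ N(v) − 1` for an `E`-split place `v ∤ p` (`residueCard` spelling).
[cite: Serre1972, §1.11 and §5.2 (iii)] [cite: NeukirchANT1999, Ch. I (10.3)] -/
theorem dvd_residueCard_sub_one_of_isArithFrobAt_of_galoisRepTorsion_eq_one
    {v : HeightOneSpectrum (𝓞 ℚ)} {𝔓 : Ideal (absIntegers (𝓞 ℚ) ℚ)} (h𝔓 : 𝔓 ∈ v.primesAbove)
    (hp𝔓 : ((p : ℕ) : absIntegers (𝓞 ℚ) ℚ) ∉ 𝔓) {Fr : absoluteGaloisGroup ℚ}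
    (hFr : IsArithFrobAt (𝓞 ℚ) Fr 𝔓) (hsplit : galoisRepTorsion W p Fr = 1) :
    p ∣ v.residueCard - 1 := by
  have h := residueCard_eq_one_of_isArithFrobAt_of_galoisRepTorsion_eq_one W p h𝔓 hp𝔓 hFr hsplit
  have h1 : 1 ≤ v.residueCard := (HeightOneSpectrum.one_lt_residueCard v).le
  rw [← Nat.cast_one, ZMod.natCast_eq_natCast_iff] at h
  exact (Nat.modEq_iff_dvd' h1).mp h.symm

/-- `p ∣ Ideal.absNorm v.asIdeal − 1` for an `E`-split place `v ∤ p` (the `Ideal.absNorm` spelling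
of koly's `hpl`). [cite: Serre1972, §1.11 and §5.2 (iii)] [cite: NeukirchANT1999, Ch. I (10.3)] -/
theorem dvd_absNorm_sub_one_of_isArithFrobAt_of_galoisRepTorsion_eq_one
    {v : HeightOneSpectrum (𝓞 ℚ)} {𝔓 : Ideal (absIntegers (𝓞 ℚ) ℚ)} (h𝔓 : 𝔓 ∈ v.primesAbove)
    (hp𝔓 : ((p : ℕ) : absIntegers (𝓞 ℚ) ℚ) ∉ 𝔓) {Fr : absoluteGaloisGroup ℚ}
    (hFr : IsArithFrobAt (𝓞 ℚ) Fr 𝔓) (hsplit : galoisRepTorsion W p Fr = 1) :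
    p ∣ Ideal.absNorm v.asIdeal - 1 :=
  dvd_residueCard_sub_one_of_isArithFrobAt_of_galoisRepTorsion_eq_one W p h𝔓 hp𝔓 hFr hsplit

/-! ### §3 The local form at the distinguished prime of `v` -/

omit [Fact p.Prime] in
/-- `p ∉ 𝔓₀` for the distinguished prime `𝔓₀ = adicCompletionPrime ℚ v` of a place `v ∤ p`. [folklore] -/
theorem natCast_not_mem_adicCompletionPrime {v : HeightOneSpectrum (𝓞 ℚ)}
    (hpv : ((p : ℕ) : 𝓞 ℚ) ∉ v.asIdeal) :
    ((p : ℕ) : absIntegers (𝓞 ℚ) ℚ) ∉ adicCompletionPrime ℚ v := by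
  intro h
  apply hpv
  rw [← under_adicCompletionPrime ℚ v, Ideal.under_def, Ideal.mem_comap, map_natCast]
  exact h

/-- **koly's `hpl` at the Chebotarev prime, from the `E`-split local Frobenius.**  For a finite
place `v` of `ℚ` with `v ∤ p` and ANY arithmetic Frobenius `Fr_v` of the local field `ℚ_v` whose
restriction along the fixed embedding `absGaloisRestrict ℚ ℚ_v` fixes `E[p]`
(`ρ̄_{E,p}(res Fr_v) = 1` — the conjunct delivered for every local Frobenius by
`exists_forall_isAbsArithFrob_mem_inf_ker_apply_eq_smul_and_depth_of_ne_two`):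
`p ∣ Ideal.absNorm v.asIdeal − 1`. [cite: Serre1972, §1.11 and §5.2 (iii)]
[cite: NeukirchANT1999, Ch. I (10.3) and Ch. II §9 Prop. (9.6)] -/
theorem dvd_absNorm_sub_one_of_isAbsArithFrob_of_galoisRepTorsion_eq_one
    {v : HeightOneSpectrum (𝓞 ℚ)} (hpv : ((p : ℕ) : 𝓞 ℚ) ∉ v.asIdeal)
    {Frv : absoluteGaloisGroup (v.adicCompletion ℚ)} (hFrv : IsAbsArithFrob Frv)
    (hsplit : galoisRepTorsion W p (absGaloisRestrict ℚ (v.adicCompletion ℚ) Frv) = 1) :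
    p ∣ Ideal.absNorm v.asIdeal - 1 := by
  have hres : IsArithFrobAt (𝓞 ℚ) (absGaloisRestrict ℚ (v.adicCompletion ℚ) Frv)
      (adicCompletionPrime ℚ v) :=
    (isArithFrobAt_absGaloisRestrict_adicCompletionPrime_iff ℚ v
      (by rw [residueFieldCard_adicCompletion_eq ℚ v, HeightOneSpectrum.residueCard_eq_card_quotient])
      Frv).2 hFrv
  exact dvd_absNorm_sub_one_of_isArithFrobAt_of_galoisRepTorsion_eq_one W p
    (adicCompletionPrime_mem_primesAbove ℚ v) (natCast_not_mem_adicCompletionPrime p hpv) hres hsplit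

/-- The same with the `E`-split hypothesis in the `DiscreteGaloisModule` spelling
`W.torsionGaloisModule p (res Fr_v) = 1` (koly's `hsplit`). [cite: Serre1972, §1.11 and §5.2 (iii)]
[cite: NeukirchANT1999, Ch. I (10.3) and Ch. II §9 Prop. (9.6)] -/
theorem dvd_absNorm_sub_one_of_isAbsArithFrob_of_torsionGaloisModule_eq_one
    {v : HeightOneSpectrum (𝓞 ℚ)} (hpv : ((p : ℕ) : 𝓞 ℚ) ∉ v.asIdeal)
    {Frv : absoluteGaloisGroup (v.adicCompletion ℚ)} (hFrv : IsAbsArithFrob Frv)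
    (hsplit : W.torsionGaloisModule (p : ℤ) (absGaloisRestrict ℚ (v.adicCompletion ℚ) Frv) = 1) :
    p ∣ Ideal.absNorm v.asIdeal - 1 :=
  dvd_absNorm_sub_one_of_isAbsArithFrob_of_galoisRepTorsion_eq_one W p hpv hFrv
    (galoisRepTorsion_eq_one_of_forall_smul_eq W p fun P => by
      rw [← torsionGaloisModule_apply_apply, hsplit]; rfl)

end Summit.BirchSwinnertonDyer.BirchSwinnertonDyer.Rank1Residual.SplitPrime

end
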